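import Summits.HodgeConjecture.HodgeConjecture.Theorems.Ring2ClassTargetsRowsSixSevenWeilPullbacks
import Summits.HodgeConjecture.HodgeConjecture.Theorems.Ring2TransportWeilClasses
import HarnessLib

/-!
# Ring 2 — class targets, rows 6 and 7: the JUNCTION with the Weil-type ladder and the transport column

research route conditional on HC_CM; not a corollary; Q11.4-sentence-2 already refuted in dim ≥ 3.

Cell `pub-hodge-ring2`, seat typer1 = cell LEAD (gen 4). `HC_CM` := the binder
`Theses.RankFourFaces.CMAbelianHodge` (stmt-HodgeConjecture-3052) BY NAME; nothing here proves it or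
`CMToAbelian` (stmt-16267). This file JOINS three columns of the cell's map on the matrix rows `g = 6, 7`
(`HCUpToDim 7` = the Hodge conjecture for every complex abelian variety of dimension `≤ 7`):

* the CLASS-TARGET axis (`Ring2ClassTargetsRowsSixSevenWeilPullbacks`, p193119): rows `≤ 7` ⟸ {X2′ =
  `CodimTwoFromWeilPullbacks`, X1, `W₆`, the codimension-2 slice of R3, floor} off a granted class `𝒞`;
* the WEIL-TYPE LADDER (`Theorems/WeilTypeLadder*.lean`): R∞ = `WeilClassesImaginaryQuadratic` (every `n ≥ 2`,
  every `d`), R3 = `WeilClassesCMField` (CM fields of degree `> 2`), both OPEN, both cases of the summit;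
* the TRANSPORT column (`Ring2TransportWeilClasses`, p190858 ff.): R∞ ⟸ `HC_CM` + CM-pointed quadratic Weil
  families + the local Weil-confined variational germ at CM fibres; R3 ⟸ `HC_CM` + CM-pointed `K`-Weil families +
  Weil-confined variational Hodge for `K` (all typed OPEN leaves of that file, none a Literature fact).

RESULTS (all by composition of landed theorems; no new hypothesis is minted):
* `span_codimTwoWeilPullbacks_le_algebraicClasses_of_rungs` — André's codimension-2 Weil pull-backs (the third
  summand of X2′; by the cell's computation `K3-WEIL-PULLBACK.md` they contain the K3-partner exceptional classes)
  are algebraic on EVERY abelian variety, given R∞ at `n = 2` (through the floor) and R3 at `2m = 4`;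
* `hcUpToDim_seven_of_rungs_of_census` — rows `≤ 7` ⟸ R∞ ∧ R3 ∧ Moonen–Zarhin's two codimension-2 facts
  (refereed) ∧ the GENERATION census X2′ ∧ X1: `HC_CM` ABSENT, no class `𝒞` needed;
* `hcUpToDim_seven_of_andre_of_rungs_of_censusOffCM` — the same with the census demanded only OFF the CM locus,
  `HC_CM` being DISCHARGED by André's theorem from the two rungs (`rankFourFaces_cmAbelianHodge_of_andre_of_rungs`);
* `hcUpToDim_seven_of_hcCM_of_transport_of_censusOffCM` — rows `≤ 7` ⟸ `HC_CM` ∧ the four transport leaves ∧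
  the two Moonen–Zarhin facts ∧ {X2′, X1 off CM}: here `HC_CM` is used three times but LOAD-BEARING exactly TWICE
  (the CM anchors of both transports) — its third use, HC on the class `𝒞 = CM`, is DISCHARGEABLE by André 1992
  from the two rungs (the previous bullet; referee 1 F55) — and what remains beyond `HC_CM` + transport is a pure
  HODGE-RING GENERATION census of the non-CM 6- and 7-folds (no cycle input) — the statement the atlas / motiv
  engines decide cell by cell (AV-HODGE-ATLAS; RING2-MAP §motiv gen 6–7).
K3-WP (the K3-partner classes lie in the third summand of X2′) is a COMPUTATION certified under the cell rule (two
independent implementations: typer1 A/B, referee 2's `ref2_k3wp_check_g29.py`; 0 mismatches) + a hand proof —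
NOT in print, NOT a Lean theorem; no statement below depends on it.
Honest column: X2′ and X1 are NOT consequences of HC; the transport leaves are OPEN and partly sourced to
UNREFEREED preprints (Markman 2025) in their home file; R∞ at `n = 2` is Markman's fourfold theorem only for the
discriminants he covers (UNREFEREED beyond); nothing here is a new case of the Hodge conjecture.
-/

set_option linter.dupNamespace false

noncomputable section

open CategoryTheory Literature.AlgebraicGeometry Literature.AlgebraicGeometry.Motives
open Literature.AlgebraicGeometry.HodgeTheory Literature.AlgebraicGeometry.Milne1999
open Literature.AlgebraicTopology.SingularHomology Literature.Barriers.HodgeConjecture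

namespace Summit.HodgeConjecture.HodgeConjecture.Ring2.ClassTargets

open WeilTypeLadder Ring2Transport

/-! ## §J1 André's codimension-2 Weil pull-backs are algebraic, given the two rungs -/

/-- **The third summand of X2′ is algebraic on every abelian variety, given R∞ (at `n = 2`, read through the
floor `HCUpToDim 5`, itself from R∞ and Moonen–Zarhin's codimension-2 facts) and R3 (at `2m = 4`).** By the cell's
computation (evidence `K3-WEIL-PULLBACK.md` on stmt-HodgeConjecture-18721) this summand contains the K3-partner
exceptional classes, so their algebraicity is a case of R∞[n = 2] ∧ R3[`E` quartic, `2m = 4`, dim 8].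
[cite: Andre1992HodgeCM, Théorème] [cite: MoonenZarhin1999LowDim, Thms. 0.1, 0.2] [cite: MoonenZarhin1998WeilClasses, §1] -/
theorem span_codimTwoWeilPullbacks_le_algebraicClasses_of_rungs (hR : WeilClassesImaginaryQuadratic)
    (hR3 : WeilClassesCMField) (h01 : MoonenZarhin1999_codimTwoHodgeClasses_abelianFourfold)
    (h02 : MoonenZarhin1999_codimTwoHodgeClasses_abelianFivefold) (A : AbelianVariety ℂ) :
    Submodule.span ℂ (codimTwoWeilPullbacks A) ≤ algebraicClasses A.X 2 := by
  have hX : IsSmoothProjective A.dim A.X := AbelianVariety.isSmoothProjective_holds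
  have h₅ : HCUpToDim 5 :=
    hcUpToDim_five_of_codimTwoFacts_of_weilClassesFourfolds h01 h02
      (floorFourfolds_of_weilClassesImaginaryQuadratic hR)
  refine Submodule.span_le.mpr ?_
  rintro _ (⟨B, g, d, ψ, w, hB, _, _, hw, hwt, _, rfl⟩ | ⟨B, g, ψ, P, e, w, hP, hPe, he, hirr, hev,
    hdim, hreal, hQ, hweil, hw, hwt, rfl⟩)
  · refine map_mem_algebraicClasses_of_abelianVariety hX B g ((h₅ B (by omega)).2 2 w hw ?_)
    rw [hB]; exact hwt
  · exact map_mem_algebraicClasses_of_abelianVariety hX B g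
      (hR3 B ψ P e 2 hP hPe he hirr hev hdim hreal hQ w hweil hw hwt)

/-! ## §J2 Rows `≤ 7` from the two Weil rungs and the generation census (`HC_CM` absent) -/

/-- **Rows `≤ 7` ⟸ R∞ ∧ R3 ∧ Moonen–Zarhin (Thms. 0.1, 0.2) ∧ X2′ ∧ X1** — no class `𝒞`, no `HC_CM`: the floor
is R∞[n = 2] + Moonen–Zarhin, `W₆` is R∞[n = 3], the codimension-2 CM-field slice is R3[2m = 4].
[cite: MoonenZarhin1999LowDim, Thms. 0.1, 0.2 and §5] [cite: Markman2025SurveySecant, §11.5–§12 (preprint, unrefereed)] -/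
theorem hcUpToDim_seven_of_rungs_of_census (hR : WeilClassesImaginaryQuadratic) (hR3 : WeilClassesCMField)
    (h01 : MoonenZarhin1999_codimTwoHodgeClasses_abelianFourfold)
    (h02 : MoonenZarhin1999_codimTwoHodgeClasses_abelianFivefold)
    (h₃ : CodimTwoFromWeilPullbacks) (h₂ : Theses.SevenfoldWeilCensus.CodimThreeWeilGeneration) : HCUpToDim 7 :=
  hcUpToDim_seven_of_censusOff_weilPullbacks (𝒞 := fun _ ↦ False) (fun _ h ↦ h.elim)
    (codimTwoFromWeilPullbacksOff_of h₃ _) (codimThreeWeilGenerationOff_of h₂ _)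
    (weilSixfoldsOff_of (weilSixfolds_of_weilClassesImaginaryQuadratic hR) _)
    (codimTwoWeilClassesCMFieldOff_of_weilClassesCMField hR3 _)
    (hcUpToDim_five_of_codimTwoFacts_of_weilClassesFourfolds h01 h02
      (floorFourfolds_of_weilClassesImaginaryQuadratic hR))

/-- **Same, census only OFF the CM locus; `HC_CM` DISCHARGED by André 1992 from the two rungs**
(`rankFourFaces_cmAbelianHodge_of_andre_of_rungs`, tree; André = the Literature fact p176378). In this reading
`HC_CM` is not an input at all. [cite: Andre1992HodgeCM, Théorème] [cite: CharlesSchnell2014Notes, Thm. 11.5.21] -/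
theorem hcUpToDim_seven_of_andre_of_rungs_of_censusOffCM
    (hA : Andre1992_hodgeClasses_cmAbelianVariety_mem_span_pullback_weilClasses)
    (hR : WeilClassesImaginaryQuadratic) (hR3 : WeilClassesCMField)
    (h01 : MoonenZarhin1999_codimTwoHodgeClasses_abelianFourfold)
    (h02 : MoonenZarhin1999_codimTwoHodgeClasses_abelianFivefold)
    (h₃ : CodimTwoFromWeilPullbacksOff IsOfCMType) (h₂ : CodimThreeWeilGenerationOff IsOfCMType) : HCUpToDim 7 :=
  hcUpToDim_seven_of_hcCM_of_censusOffCM_weilPullbacks (rankFourFaces_cmAbelianHodge_of_andre_of_rungs hA hR hR3)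
    h₃ h₂ (weilSixfoldsOff_of (weilSixfolds_of_weilClassesImaginaryQuadratic hR) _)
    (codimTwoWeilClassesCMFieldOff_of_weilClassesCMField hR3 _)
    (hcUpToDim_five_of_codimTwoFacts_of_weilClassesFourfolds h01 h02
      (floorFourfolds_of_weilClassesImaginaryQuadratic hR))

/-! ## §J3 Rows `≤ 7` from `HC_CM`, the transport leaves and the generation census off CM -/

/-- **THE JUNCTION.** Rows `≤ 7` ⟸ `HC_CM` ∧ {CM-pointed quadratic Weil families, local Weil-VHC germ at CM fibres}
(⟹ R∞, `HC_WeilClassesQuadratic_of_HC_CM_local`) ∧ {CM-pointed `K`-Weil families, Weil-confined VHC for `K`}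
(⟹ R3, `HC_WeilClassesCMField_of_HC_CM`) ∧ Moonen–Zarhin Thms. 0.1/0.2 ∧ {X2′ off CM, X1 off CM}. `HC_CM` is
LOAD-BEARING exactly twice (the CM anchors of both transports); its third use here (HC on the class `𝒞 = CM`) is
André-dischargeable from the rungs (`hcUpToDim_seven_of_andre_of_rungs_of_censusOffCM`); beyond `HC_CM` + transport
only a HODGE-RING GENERATION census of the non-CM 6- and 7-folds remains (no cycle input). The transport leaves are OPEN typed statements of
`Ring2TransportWeilClasses` (partly sourced to unrefereed preprints there). [cite: Milne1999, §7 (H)]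
[cite: Deligne1982HodgeCycles, §4–5] [cite: Markman2025SecantRealMultiplication, Cor. 10.2.3 (preprint, unrefereed)]
[cite: MoonenZarhin1999LowDim, Thms. 0.1, 0.2 and §5] -/
theorem hcUpToDim_seven_of_hcCM_of_transport_of_censusOffCM (hCM : Theses.RankFourFaces.CMAbelianHodge)
    (hPq : CMPointedWeilFamiliesQuadratic) (hLq : LocalWeilVHCAtCMQuadratic)
    (hP : CMPointedWeilFamiliesCMField) (hV : WeilVariationalHodgeCMField)
    (h01 : MoonenZarhin1999_codimTwoHodgeClasses_abelianFourfold)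
    (h02 : MoonenZarhin1999_codimTwoHodgeClasses_abelianFivefold)
    (h₃ : CodimTwoFromWeilPullbacksOff IsOfCMType) (h₂ : CodimThreeWeilGenerationOff IsOfCMType) : HCUpToDim 7 :=
  have hR : WeilClassesImaginaryQuadratic := HC_WeilClassesQuadratic_of_HC_CM_local hCM hPq hLq
  hcUpToDim_seven_of_hcCM_of_censusOffCM_weilPullbacks hCM h₃ h₂
    (weilSixfoldsOff_of (weilSixfolds_of_weilClassesImaginaryQuadratic hR) _)
    (codimTwoWeilClassesCMFieldOff_of_weilClassesCMField (HC_WeilClassesCMField_of_HC_CM hCM hP hV) _)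
    (hcUpToDim_five_of_codimTwoFacts_of_weilClassesFourfolds h01 h02
      (floorFourfolds_of_weilClassesImaginaryQuadratic hR))

/-- **The K3-partner summand under `HC_CM` + transport**: André's codimension-2 Weil pull-backs are algebraic on
every abelian variety. With `K3-WEIL-PULLBACK.md`: the K3-partner exceptional classes ⟸ `HC_CM` + the four transport
leaves + Moonen–Zarhin — the cell's transport column COVERS the K3-partner row (RING2-MAP §LEAD gen 6).
[cite: Andre1992HodgeCM, Théorème] [cite: Deligne1982HodgeCycles, §4–5] -/
theorem span_codimTwoWeilPullbacks_le_algebraicClasses_of_hcCM_of_transport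
    (hCM : Theses.RankFourFaces.CMAbelianHodge)
    (hPq : CMPointedWeilFamiliesQuadratic) (hLq : LocalWeilVHCAtCMQuadratic)
    (hP : CMPointedWeilFamiliesCMField) (hV : WeilVariationalHodgeCMField)
    (h01 : MoonenZarhin1999_codimTwoHodgeClasses_abelianFourfold)
    (h02 : MoonenZarhin1999_codimTwoHodgeClasses_abelianFivefold) (A : AbelianVariety ℂ) :
    Submodule.span ℂ (codimTwoWeilPullbacks A) ≤ algebraicClasses A.X 2 :=
  span_codimTwoWeilPullbacks_le_algebraicClasses_of_rungs (HC_WeilClassesQuadratic_of_HC_CM_local hCM hPq hLq)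
    (HC_WeilClassesCMField_of_HC_CM hCM hP hV) h01 h02 A

/-! ## §J4 Audit: on-path where it exists -/

/-- Every LADDER / FACT-FREE hypothesis of §J2 except the generation census follows from the summit (on-path lemmas
of the tree); X2′, X1 and the Moonen–Zarhin facts are Hodge-theoretic inputs, not consequences of HC, and the
CM-pointed-family leaves of §J3 have no on-path lemma (see their home file). [cite: Deligne2000, §1] -/
theorem rungs_of_hodgeConjecture (h : _root_.HodgeConjecture) :
    WeilClassesImaginaryQuadratic ∧ WeilClassesCMField ∧ Theses.RankFourFaces.CMAbelianHodge :=
  ⟨weilClassesImaginaryQuadratic_of_hodgeConjecture h, weilClassesCMField_of_hodgeConjecture h,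
    HC_CM_of_HodgeConjecture h⟩

end Summit.HodgeConjecture.HodgeConjecture.Ring2.ClassTargets

end
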